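import Literature.Analysis.FluidPDE.NSLocalAnalyticityRadiusTube
import Literature.Analysis.Complex.SeveralVariables

/-!
# ScalingDefectPeepholeDoorTubeCalculus — door S30 «ScalingDefectPeepholeDoor» v2 (nsreg-p1 g24 ROUND-28 v2 6cf1a9889313ec10),
# plate P2 = K1ω `VortexDefectTubeBound`, part T1: CALCULUS OF HOLOMORPHIC EXTENSIONS ON THE LOCAL COMPLEX TUBE

Generic several-complex-variables plumbing for the vortex-defect tube bound (K1ω): the datum `vortexDefect 1 W = curl(ΔW − DW[W] − ½W −
½DW[y])` of the window field `W` is a differential polynomial of order three in `W`; its holomorphic extension to a complex tube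
`localComplexTube 0 A δ` with a CLASS bound is obtained from a bounded holomorphic extension `U` of `W` itself by three rounds of
«differentiate in a real coordinate direction»:

* `add_smul_complexify_mem_localComplexTube` — the complex disc `{z + t·v : |t| ≤ s}` through a point `z` of the shrunken tube
  `localComplexTube x₀ (ρ−s) (h−s)` in a real unit direction `v` stays in `localComplexTube x₀ ρ h`.
* `dirDeriv_differentiableOn`, `norm_dirDeriv_le_of_mem_shrink` — CAUCHY ESTIMATE ON THE TUBE: for `U` holomorphic on the tube with
  `‖U‖ ≤ M`, the directional derivative `z ↦ DU(z)[v]` is holomorphic on the tube and `≤ M/s` on the `s`-shrunken tube (tree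
  `Literature.Analysis.Complex.SCV.differentiableOn_fderiv_apply`, `….norm_fderiv_apply_le`).
* `fderiv_apply_complexify_eq` — REAL-SLICE AGREEMENT: if `U ∘ complexify = complexify ∘ g` on an open real set whose complexification
  lies in the (open) domain of holomorphy, then `DU(y)[v] = complexify (Dg(y)[v])` at its real points (both are the derivative at
  `r = 0` of `r ↦ U(y + r v)`).

Folklore complex analysis; no statement of the door is declared here.  Door S30 is a regularity CRITERION inside a HYPOTHETICAL local
Type-I blow-up (item 0056 `NoTypeII` stays OPEN); nothing here bears on NS regularity itself.
-/

noncomputable section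

set_option linter.dupNamespace false

namespace Summit.NavierStokesRegularity.NavierStokesRegularity.Theorems.ScalingDefectPeepholeDoor

open Set Function Filter Metric TopologicalSpace Complex
open scoped Topology
open Literature.Analysis Literature.Analysis.FluidPDE Literature.Analysis.Complex
open Literature.Analysis.FunctionSpaces.EuclideanSpace (complexify norm_complexify complexify_apply)

/-! ## §1 Complex discs in real directions inside the tube -/

/-- `t • complexify v = complexify (Re t • v) + i • complexify (Im t • v)`. -/
theorem smul_complexify_eq (t : ℂ) (v : EuclideanSpace ℝ (Fin 3)) :
    t • complexify v = complexify (t.re • v) + Complex.I • complexify (t.im • v) := by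
  ext i
  simp only [PiLp.smul_apply, PiLp.add_apply, complexify_apply, smul_eq_mul, Complex.ofReal_mul]
  calc t * (v i : ℂ) = (t.re + t.im * Complex.I) * (v i : ℂ) := by rw [Complex.re_add_im]
    _ = _ := by ring

/-- **The complex disc through a point of the shrunken tube in a real direction stays in the tube**: for `dist x x₀ < ρ − s`,
`‖y‖ < h − s`, `‖v‖ ≤ 1` and `|t| ≤ s`, `x + iy + t v ∈ localComplexTube x₀ ρ h`. -/
theorem add_smul_complexify_mem_localComplexTube {x₀ x y v : EuclideanSpace ℝ (Fin 3)} {ρ h s : ℝ} (hv : ‖v‖ ≤ 1)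
    (hx : dist x x₀ < ρ - s) (hy : ‖y‖ < h - s) {t : ℂ} (ht : ‖t‖ ≤ s) :
    complexify x + Complex.I • complexify y + t • complexify v ∈ localComplexTube x₀ ρ h := by
  rw [mem_localComplexTube_iff]
  refine ⟨x + t.re • v, y + t.im • v, ?_, ?_, ?_⟩
  · have h1 : ‖t.re • v‖ ≤ s := by
      rw [norm_smul, Real.norm_eq_abs]
      calc |t.re| * ‖v‖ ≤ ‖t‖ * 1 := mul_le_mul (Complex.abs_re_le_norm t) hv (norm_nonneg _) (norm_nonneg _)
        _ ≤ s := by rw [mul_one]; exact ht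
    calc dist (x + t.re • v) x₀ ≤ dist x x₀ + ‖t.re • v‖ := by
          rw [dist_eq_norm, dist_eq_norm, show x + t.re • v - x₀ = (x - x₀) + t.re • v by abel]
          exact norm_add_le _ _
      _ < ρ := by linarith
  · have h1 : ‖t.im • v‖ ≤ s := by
      rw [norm_smul, Real.norm_eq_abs]
      calc |t.im| * ‖v‖ ≤ ‖t‖ * 1 := mul_le_mul (Complex.abs_im_le_norm t) hv (norm_nonneg _) (norm_nonneg _)
        _ ≤ s := by rw [mul_one]; exact ht
    calc ‖y + t.im • v‖ ≤ ‖y‖ + ‖t.im • v‖ := norm_add_le _ _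
      _ < h := by linarith
  · rw [smul_complexify_eq t v, map_add, map_add, smul_add]
    abel

/-! ## §2 Cauchy estimate for directional derivatives on the tube -/

/-- **Directional derivatives of a holomorphic map on the tube are holomorphic there.** -/
theorem dirDeriv_differentiableOn {U : EuclideanSpace ℂ (Fin 3) → EuclideanSpace ℂ (Fin 3)}
    {x₀ : EuclideanSpace ℝ (Fin 3)} {ρ h : ℝ} (hU : DifferentiableOn ℂ U (localComplexTube x₀ ρ h))
    (w : EuclideanSpace ℂ (Fin 3)) :
    DifferentiableOn ℂ (fun z => fderiv ℂ U z w) (localComplexTube x₀ ρ h) :=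
  SCV.differentiableOn_fderiv_apply hU (isOpen_localComplexTube x₀ ρ h) w

/-- **Cauchy estimate on the tube**: `‖U‖ ≤ M` on `localComplexTube x₀ ρ h` and `‖v‖ ≤ 1` give `‖DU(z)[v]‖ ≤ M/s` on the
`s`-shrunken tube `localComplexTube x₀ (ρ−s) (h−s)`. -/
theorem norm_dirDeriv_le_of_mem_shrink {U : EuclideanSpace ℂ (Fin 3) → EuclideanSpace ℂ (Fin 3)}
    {x₀ : EuclideanSpace ℝ (Fin 3)} {ρ h M s : ℝ} (hU : DifferentiableOn ℂ U (localComplexTube x₀ ρ h))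
    (hM : ∀ z ∈ localComplexTube x₀ ρ h, ‖U z‖ ≤ M) (hs : 0 < s) {v : EuclideanSpace ℝ (Fin 3)} (hv : ‖v‖ ≤ 1)
    {z : EuclideanSpace ℂ (Fin 3)} (hz : z ∈ localComplexTube x₀ (ρ - s) (h - s)) :
    ‖fderiv ℂ U z (complexify v)‖ ≤ M / s := by
  obtain ⟨x, y, hx, hy, rfl⟩ := hz
  refine SCV.norm_fderiv_apply_le hU (isOpen_localComplexTube x₀ ρ h) hs (fun t ht => ?_) (fun t ht => hM _ ?_)
  · exact add_smul_complexify_mem_localComplexTube hv hx hy (mem_closedBall_zero_iff.1 ht)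
  · exact add_smul_complexify_mem_localComplexTube hv hx hy (le_of_eq (mem_sphere_zero_iff_norm.1 ht))

/-! ## §3 Real-slice agreement of derivatives -/

/-- the real line `r ↦ y + r v`, complexified: `complexify (y + r • v) = complexify y + (r : ℂ) • complexify v`. -/
theorem complexify_add_smul (y v : EuclideanSpace ℝ (Fin 3)) (r : ℝ) :
    complexify (y + r • v) = complexify y + (r : ℂ) • complexify v := by
  rw [map_add, LinearIsometry.map_smul, Complex.coe_smul]

/-- **Real-slice agreement**: `U` holomorphic on an open `T ⊆ ℂ³`, `g` differentiable on an open `s ⊆ ℝ³` with `complexify '' s ⊆ T` and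
`U (complexify y) = complexify (g y)` on `s` ⇒ `DU(complexify y)[complexify v] = complexify (Dg(y)[v])` for `y ∈ s`. -/
theorem fderiv_apply_complexify_eq {U : EuclideanSpace ℂ (Fin 3) → EuclideanSpace ℂ (Fin 3)}
    {g : EuclideanSpace ℝ (Fin 3) → EuclideanSpace ℝ (Fin 3)} {T : Set (EuclideanSpace ℂ (Fin 3))} (hT : IsOpen T)
    (hU : DifferentiableOn ℂ U T) {s : Set (EuclideanSpace ℝ (Fin 3))} (hs : IsOpen s)
    (hsT : ∀ y ∈ s, complexify y ∈ T) (hUg : ∀ y ∈ s, U (complexify y) = complexify (g y))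
    (hg : DifferentiableOn ℝ g s) {y : EuclideanSpace ℝ (Fin 3)} (hy : y ∈ s) (v : EuclideanSpace ℝ (Fin 3)) :
    fderiv ℂ U (complexify y) (complexify v) = complexify (fderiv ℝ g y v) := by
  set z : EuclideanSpace ℂ (Fin 3) := complexify y with hz
  set w : EuclideanSpace ℂ (Fin 3) := complexify v with hw
  -- the complex side: derivative of `r ↦ U (z + r w)` at `0`
  have hline : HasDerivAt (fun r : ℝ => z + (r : ℂ) • w) w 0 := by
    have h := ((Complex.ofRealCLM.hasDerivAt (x := (0 : ℝ))).smul_const w).const_add z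
    simpa using h
  have hUd : HasFDerivAt U (fderiv ℂ U z) z := (hU.differentiableAt (hT.mem_nhds (hsT y hy))).hasFDerivAt
  have hUd' : HasFDerivAt (𝕜 := ℝ) U ((fderiv ℂ U z).restrictScalars ℝ) (z + ((0 : ℝ) : ℂ) • w) := by
    rw [Complex.ofReal_zero, zero_smul, add_zero]
    exact hUd.restrictScalars ℝ
  have h1 : HasDerivAt (fun r : ℝ => U (z + (r : ℂ) • w)) (fderiv ℂ U z w) 0 := by
    have := hUd'.comp_hasDerivAt (0 : ℝ) hline
    exact this
  -- the real side: derivative of `r ↦ complexify (g (y + r v))` at `0`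
  have hl2 : HasDerivAt (fun r : ℝ => y + r • v) v 0 := by
    simpa using ((hasDerivAt_id (0 : ℝ)).smul_const v).const_add y
  have hgd : HasFDerivAt g (fderiv ℝ g y) (y + (0 : ℝ) • v) := by
    rw [zero_smul, add_zero]
    exact (hg.differentiableAt (hs.mem_nhds hy)).hasFDerivAt
  have h2 : HasDerivAt (fun r : ℝ => complexify (g (y + r • v))) (complexify (fderiv ℝ g y v)) 0 := by
    have h2a : HasDerivAt (fun r : ℝ => g (y + r • v)) (fderiv ℝ g y v) 0 := hgd.comp_hasDerivAt (0 : ℝ) hl2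
    exact (complexify : EuclideanSpace ℝ (Fin 3) →ₗᵢ[ℝ] EuclideanSpace ℂ (Fin 3)).toContinuousLinearMap.hasFDerivAt
      |>.comp_hasDerivAt (0 : ℝ) h2a
  -- the two curves agree near `r = 0`
  have hnear : ∀ᶠ r : ℝ in 𝓝 0, y + r • v ∈ s := by
    have hc : Continuous fun r : ℝ => y + r • v := continuous_const.add (continuous_id.smul continuous_const)
    exact hc.continuousAt.preimage_mem_nhds (hs.mem_nhds (by simpa using hy))
  have heq : (fun r : ℝ => complexify (g (y + r • v))) =ᶠ[𝓝 0] fun r : ℝ => U (z + (r : ℂ) • w) := by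
    filter_upwards [hnear] with r hr
    rw [hz, hw, ← complexify_add_smul, hUg _ hr]
  exact (h1.congr_of_eventuallyEq heq).unique h2

/-! ## §4 The iterable «∂ᵥ-extension» package on a local tube over a ball centred at the origin -/

/-- **∂ᵥ-extension lemma** (one round of the K1ω recursion): `U` holomorphic on `localComplexTube 0 ρ h` (`h > 0`) with `‖U‖ ≤ M`,
agreeing with `complexify ∘ g` on the real ball `B(0, ρ)` where `g` is differentiable, and a real direction `‖v‖ ≤ 1`: the
directional derivative `U_v = DU[complexify v]` is holomorphic on the same tube, bounded by `M/s` on the `s`-shrunken tube, and agrees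
with `complexify ∘ (Dg[v])` on `B(0, ρ)`. -/
theorem dirDeriv_extension {U : EuclideanSpace ℂ (Fin 3) → EuclideanSpace ℂ (Fin 3)}
    {g : EuclideanSpace ℝ (Fin 3) → EuclideanSpace ℝ (Fin 3)} {ρ h M s : ℝ} (hh : 0 < h)
    (hU : DifferentiableOn ℂ U (localComplexTube 0 ρ h)) (hM : ∀ z ∈ localComplexTube 0 ρ h, ‖U z‖ ≤ M)
    (hUg : ∀ y ∈ ball (0 : EuclideanSpace ℝ (Fin 3)) ρ, U (complexify y) = complexify (g y))
    (hg : DifferentiableOn ℝ g (ball (0 : EuclideanSpace ℝ (Fin 3)) ρ)) (hs : 0 < s)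
    {v : EuclideanSpace ℝ (Fin 3)} (hv : ‖v‖ ≤ 1) :
    DifferentiableOn ℂ (fun z => fderiv ℂ U z (complexify v)) (localComplexTube 0 ρ h) ∧
      (∀ z ∈ localComplexTube 0 (ρ - s) (h - s), ‖fderiv ℂ U z (complexify v)‖ ≤ M / s) ∧
      ∀ y ∈ ball (0 : EuclideanSpace ℝ (Fin 3)) ρ,
        fderiv ℂ U (complexify y) (complexify v) = complexify (fderiv ℝ g y v) := by
  refine ⟨dirDeriv_differentiableOn hU _, fun z hz => norm_dirDeriv_le_of_mem_shrink hU hM hs hv hz, fun y hy => ?_⟩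
  refine fderiv_apply_complexify_eq (isOpen_localComplexTube 0 ρ h) hU isOpen_ball (fun y' hy' => ?_) hUg hg hy v
  exact complexify_mem_localComplexTube hh (by rwa [mem_ball] at hy')

end Summit.NavierStokesRegularity.NavierStokesRegularity.Theorems.ScalingDefectPeepholeDoor

end
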